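import Summits.AtomisticToContinuum.BoseEinsteinCondensation.Theses.BECThomsonPrinciple
import Summits.AtomisticToContinuum.BoseEinsteinCondensation.Theorems.GaussianDominationCan.Negative.CruxForms
import Summits.AtomisticToContinuum.BoseEinsteinCondensation.Theorems.GaussianDominationCan.Negative.LoadBearing
import Summits.AtomisticToContinuum.BoseEinsteinCondensation.Theorems.GaussianDominationCan.Negative.FreeConstant
import HarnessLib
import HarnessLib.Audit

/-!
# Line `coupling-monotone-chord` — crux `GaussianDominationCan` (stmt-AtomisticToContinuum-9479) — LEAD SKELETON

Lead prover-line-stmt-AtomisticToContinuum-9479-0, reshape of the planner's `Lines/coupling-monotone-chord.lean`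
(2026-08-16): stub A split into A1 `stub_modeBessel`, A2 `stub_thetaNorm`, A3 `stub_freeAnchorOf`; stub D split into
the proved glue `truncationLimit_of_lsc` + D2 `stub_truncatedEnergyLSC`; bookkeeping stub `stub_compose` (proved).
The vocabulary below is VERBATIM the route Defs file `Theorems/BECThomsonPrincipleGaussianDominationCanDefs.lean`
(proposed; once it is in the tree this inline copy is replaced by the import).  Sorries only in `stub_*`.

# (Defs file docstring follows)

Route-posited objects (D-0016 `<Route><Crux>Defs` file; precedents `BECThomsonPrincipleDefs.lean`,
`BECThomsonPrincipleDensityResponseDefs.lean`) shared by the registered stubs of the checked skeleton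
`Cruxes/GaussianDominationCan/Lines/coupling-monotone-chord.lean` (lead reshape 2026-08-16: stubs
`stub_modeBessel`, `stub_thetaNorm`, `stub_freeAnchorOf`, `stub_sourceRaisesInteraction`,
`stub_chordTransport`, `stub_truncatedEnergyLSC`, bookkeeping `stub_compose`) and by the crux file that
composes them.  NOTHING IS ASSERTED here: every `def … : Prop` is a *statement* (a stub signature or an
intermediate goal), consumed only as the type of a stub theorem or as an explicit hypothesis of the
bookkeeping stub `stub_compose` proved at the end (sorry-free); the other stub theorems land one per file
under `Theorems/BECThomsonPrincipleGaussianDominationCan<Stub>.lean` (`--supports` the crux item)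
importing this module.

**The crux** (`Theses/BECThomsonPrinciple.lean`, `def GaussianDominationCan`; in the disprover's landed
vocabulary `Negative.CruxForms` it is `∀ v M, ∃ ρ₀ C N₀, GDCanWith ρ₀ C N₀ v M` by `Iff.rfl`): the chord
(Gaussian-domination) inequality `E₀(v) + s·2N|I(Φ)| ≤ E_v(Φ) + C s² L²/‖n‖²` for the
Lewin–Nam–Serfaty–Solovej source (`N·I(Φ) = ⟨Φ, Λ_k†Φ⟩`), for all `s ≥ 0` and all periodic Bose trial
states, uniformly down the density scale.

**The line** (card `Cruxes/GaussianDominationCan/Ideas/coupling-monotone-chord.md`, line card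
`Lines/coupling-monotone-chord.md`).  Along the coupling ray `τ ↦ τ•w` of a BOUNDED admissible potential
the sourced ground-state energy `e(τ, s) = inf_Φ [E_{τw}(Φ) − 2sN|I(Φ)|]` is concave in `τ` with right
slope the least interaction energy of asymptotically exact near-minimisers (`groundInteraction`); ONE
SIGN — the source never lowers the ground-state interaction energy (`SourceRaisesInteraction`, stub B,
open) — makes the optimal chord constant antitone along the ray (`ChordTransport`, stub C); at `τ = 0`
the chord holds with the sharp constant `1/(4π²)` (`FreeAnchor`, from the one-mode gradient Bessel
inequality `ModeBessel` and the Bose counting bound `ThetaNorm`, stubs A1–A3); hard cores are the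
monotone limit of bounded truncations (`TruncationLimit`, reduced here to the lower semicontinuity
`TruncatedEnergyLSC`, stub D2).  Composition: `stub_compose`.

Objects (over `PeriodicBoseGas.lean` and the landed `Negative.{ProductCalculus,CruxForms}` vocabulary
`cellAvg`, `theta`, `phase`, `sourceIntegral`, `nsq`, `GDIneq`, `InWindow`, `GDCanWith`; units
`ħ = 2m = 1`): `GDChordBody`, `scalePot`, `trunc`, `interactionEnergy`, `sourcedFunctional`,
`IsSourcedNearMin`, `groundInteraction`, `SourceRaisesInteractionAt`, `modeCoeff`; statements
`FreeAnchor`, `ModeBessel`, `ThetaNorm`, `FreeAnchorOf`, `SourceRaisesInteraction`, `ChordTransport`,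
`TruncatedEnergyLSC`, `TruncationLimit`; audit aliases `Goal.stub_*`; glue `periodicEnergy_mono`,
`truncationLimit_of_lsc`, `gaussianDominationCan_of_parts`, `stub_compose`.

References: E. H. Lieb, R. Seiringer, J. P. Solovej, J. Yngvason, *The Mathematics of the Bose Gas and its
Condensation* (2005) App. A, C; M. Lewin, P. T. Nam, S. Serfaty, J. P. Solovej, *Comm. Pure Appl. Math.*
68 (2015) 413 (arXiv:1211.2778; the excitation map); W. Thirring, *Quantum Mathematical Physics* §3.5
(concavity of the ground-state energy in linear parameters; Hellmann–Feynman); B. Simon, *J. Funct.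
Anal.* 28 (1978) 377 (monotone convergence of forms).
-/

noncomputable section

namespace Summit.AtomisticToContinuum.BoseEinsteinCondensation.Cruxes.GaussianDominationCan.CouplingMonotoneChord

open MeasureTheory
open scoped ENNReal NNReal
open Literature.MathematicalPhysics.QuantumManyBody.BoseGas
open Summit.AtomisticToContinuum.BoseEinsteinCondensation.Theses
open Summit.AtomisticToContinuum.BoseEinsteinCondensation.Theorems.GaussianDominationCan.Negative
  (GDIneq InWindow GDCanWith gaussianDominationCan_iff sourceIntegral cellAvg theta phase nsq)

/-! ## §1 Objects -/

/-- The CHORD BODY of the crux for a potential `w`, constant `C`, `N = m+1` particles, side `L`, lattice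
momentum `n`: `∀ s ≥ 0 ∀ Φ, E₀(w) + s·2N|I(Φ)| ≤ E_w(Φ) + C s² L²/‖n‖²` (`GDIneq` of `Negative.CruxForms`,
definitionally the crux's inequality); equivalently the optimal chord constant `C*(w; m, L, n) ≤ C`. -/
def GDChordBody (w : ℝ → ℝ≥0∞) (C : ℝ) (m : ℕ) (L : ℝ) (n : Fin 3 → ℤ) : Prop :=
  ∀ s : ℝ, 0 ≤ s → ∀ Φ : PeriodicTrialState (m + 1) L, GDIneq w m L n C s Φ

/-- The coupling ray: `(τ • w)(r) = τ·w(r)` (`ENNReal.ofReal τ = 0` for `τ ≤ 0`). -/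
def scalePot (τ : ℝ) (w : ℝ → ℝ≥0∞) : ℝ → ℝ≥0∞ := fun r => ENNReal.ofReal τ * w r

/-- The bounded truncation `min(v, h)` of a potential (same range; `↑ v` as `h → ∞`). -/
def trunc (v : ℝ → ℝ≥0∞) (h : ℝ) : ℝ → ℝ≥0∞ := fun r => min (v r) (ENNReal.ofReal h)

/-- The interaction functional `W_w(Φ) = ∫_{cell^N} ∑_{i<j} w^per(xᵢ − xⱼ) |Φ|²` (the interaction part of
`periodicEnergy w Φ`; the `τ`-slope of `τ ↦ periodicEnergy (τ • w) Φ`). -/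
def interactionEnergy (w : ℝ → ℝ≥0∞) {N : ℕ} {L : ℝ} (Φ : PeriodicTrialState N L) : ℝ≥0∞ :=
  ∫⁻ X in cellN N L, periodicInteraction w L X * (‖Φ.ψ X‖₊ : ℝ≥0∞) ^ 2

/-- The SOURCED functional `F_{w,s}(Φ) = E_w(Φ) − s·2N|I(Φ)|` of a trial state (real-valued; meaningful on
finite-energy states; `inf_Φ F = min_θ E₀(H_w − s(Λ_k^θ + Λ_k^θ†))`). -/
def sourcedFunctional (w : ℝ → ℝ≥0∞) (m : ℕ) (L : ℝ) (n : Fin 3 → ℤ) (s : ℝ)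
    (Φ : PeriodicTrialState (m + 1) L) : ℝ :=
  (periodicEnergy w Φ).toReal - s * (2 * (m + 1) * ‖sourceIntegral m L n Φ.ψ‖)

/-- `Φ` is a finite-energy `δ`-near-minimiser of the sourced functional among finite-energy states. -/
def IsSourcedNearMin (w : ℝ → ℝ≥0∞) (m : ℕ) (L : ℝ) (n : Fin 3 → ℤ) (s δ : ℝ)
    (Φ : PeriodicTrialState (m + 1) L) : Prop :=
  periodicEnergy w Φ ≠ ⊤ ∧
    ∀ Φ' : PeriodicTrialState (m + 1) L, periodicEnergy w Φ' ≠ ⊤ →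
      sourcedFunctional w m L n s Φ ≤ sourcedFunctional w m L n s Φ' + δ

/-- The GROUND-STATE INTERACTION ENERGY of the sourced problem, eigenstate-free:
`lim_{δ↓0} inf { W_w(Φ) : Φ a δ-near-minimiser of F_{w,s} }` (a `⨆` of `⨅`s in `ℝ≥0∞`; the `⨅` increases
as `δ ↓ 0`).  By the variational Hellmann–Feynman (envelope) theorem it is the right derivative at `τ = 1`
of the concave `τ ↦ inf_Φ F_{τ•w, s}(Φ)`; for `s = 0` and bounded `w` it is `⟨Ψ₀, W Ψ₀⟩`. -/
def groundInteraction (w : ℝ → ℝ≥0∞) (m : ℕ) (L : ℝ) (n : Fin 3 → ℤ) (s : ℝ) : ℝ≥0∞ :=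
  ⨆ (δ : ℝ) (_ : 0 < δ),
    ⨅ (Φ : PeriodicTrialState (m + 1) L) (_ : IsSourcedNearMin w m L n s δ Φ), interactionEnergy w Φ

/-- **Source raises interaction** at fixed data `(w; m, L, n)`: for every `s ≥ 0` the ground-state
interaction energy of `H_w − s(Λ_k^θ + Λ_k^θ†)` is at least that of `H_w`. -/
def SourceRaisesInteractionAt (w : ℝ → ℝ≥0∞) (m : ℕ) (L : ℝ) (n : Fin 3 → ℤ) : Prop :=
  ∀ s : ℝ, 0 ≤ s → groundInteraction w m L n 0 ≤ groundInteraction w m L n s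

/-- The `k`-mode coefficient of particle `0` given the bath, `ĉ_k(X) = L⁻³ ∫_cell e^{-ik·y} ψ(y, X̂) dy`
(the crux's cell average `P₀` applied to `conj(e^{ik·x₀})·ψ`; independent of `x₀`; it is the cell Fourier
coefficient `cellFourierCoeff L (y ↦ ψ(update X 0 y)) n`). -/
def modeCoeff (m : ℕ) (L : ℝ) (n : Fin 3 → ℤ) (ψ : Config (m + 1) → ℂ) : Config (m + 1) → ℂ :=
  cellAvg (m + 1) L 0 (fun X => (starRingEnd ℂ) (phase m L n X) * ψ X)

/-! ## §2 Stub statements -/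

/-- **FreeAnchor** (the `τ = 0` end of the ray): for the free gas the chord body holds with the sharp
constant `C = 1/(4π²)` for EVERY `N ≥ 1`, `L > 0`, `n ≠ 0` — no window, no density condition.  Tight by
`Negative.free_const_ge`.  Derived from `ModeBessel` and `ThetaNorm` (`FreeAnchorOf`). -/
def FreeAnchor : Prop :=
  ∀ m : ℕ, ∀ L : ℝ, 0 < L → ∀ n : Fin 3 → ℤ, n ≠ 0 → GDChordBody 0 (1 / (4 * Real.pi ^ 2)) m L n

/-- **Stub A1 `stub_modeBessel`** — one-mode gradient Bessel inequality + Bose symmetry: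
`N · |k|² · ∫_{cell^N} |ĉ_k|² ≤ ∫_{cell^N} |∇Φ|²`, `|k|² = (2π/L)² ∑ⱼ nⱼ²` (`T ≥ |k|² N ‖ĉ_k‖² = |k|²⟨n_k⟩`).
Per fibre this is the single term `q = n` of the gradient Parseval identity
`tsum_sq_grad_cellFourierCoeff` for `y ↦ ψ(update X 0 y)`; integrating over the cell in `X` and Bose
symmetry turn the particle-`0` kinetic energy into `T/N`. [folklore] -/
def ModeBessel : Prop :=
  ∀ m : ℕ, ∀ L : ℝ, 0 < L → ∀ n : Fin 3 → ℤ, ∀ Φ : PeriodicTrialState (m + 1) L,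
    ENNReal.ofReal ((m + 1 : ℝ) * (4 * Real.pi ^ 2 * nsq n / L ^ 2)) *
        ∫⁻ X in cellN (m + 1) L, (‖modeCoeff m L n Φ.ψ X‖₊ : ℝ≥0∞) ^ 2 ≤
      ∫⁻ X in cellN (m + 1) L, kineticDensity Φ.ψ X

/-- **Stub A2 `stub_thetaNorm`** — Bose counting: `N ∫_{cell^N} |Θ|² ≤ 1` for
`Θ = Σ_{S∋0} |S|^{-1/2} Q_S ψ = P₀ n̂₀^{-1/2} ψ` of a periodic Bose trial state (`{P_i}` commuting self-adjoint
idempotents on continuous functions — `Negative.Structure{,II}` — so the `Q_S` are an orthogonal resolution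
of the identity, `P_i Q_S = [i ∈ S] Q_S`, and by Bose symmetry `N‖P₀AΨ‖² = ⟨AΨ, n̂₀ AΨ⟩ = ‖Ψ‖² − ‖Q_∅Ψ‖²`
for `A = Σ_S |S|^{-1/2} Q_S`).  Needs the symmetry (`Negative.gaussianDominationCan_false_without_symm`).
[folklore] -/
def ThetaNorm : Prop :=
  ∀ m : ℕ, ∀ L : ℝ, 0 < L → ∀ Φ : PeriodicTrialState (m + 1) L,
    ((m + 1 : ℕ) : ℝ≥0∞) * ∫⁻ X in cellN (m + 1) L, (‖theta m L Φ.ψ X‖₊ : ℝ≥0∞) ^ 2 ≤ 1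

/-- **Stub A3 `stub_freeAnchorOf`** — the free anchor from A1 and A2: `E₀(0) = 0` (constant state),
`Θ` is `x₀`-independent so `I(Φ) = ∫ conj(ĉ_k)·Θ` by self-adjointness of `P₀`, Cauchy–Schwarz
`(N|I|)² ≤ (N∫|ĉ_k|²)(N∫|Θ|²) ≤ T/|k|²`, `1/|k|₂² ≤ L²/(4π²‖n‖∞²)`, AM–GM in `s` (`forall_chord_iff`). [folklore] -/
def FreeAnchorOf : Prop :=
  ModeBessel → ThetaNorm → FreeAnchor

/-- **Stub B `stub_sourceRaisesInteraction`** (THE SIGN; open, hardest).  For every window parameter `M > 0`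
and range `R₀` there is a density threshold `ρ₀ = ρ₀(M, R₀) > 0` (uniform in the coupling strength) such that
for every bounded measurable `w ≥ 0` vanishing beyond `R₀`, every `N = m+1`, `L > 0` with `N ≤ ρ₀L³`, every
`n ≠ 0` in the window, switching on the LNSS source never lowers the ground-state interaction energy.  First
order in `w` is the Hartree sign `ŵ_per(k) > 0` (`kR₀ < π`); Bogoliubov `∂_a χ(Λ_k) = −16πρ/(k²+16πρa)² < 0`;
infrared content at order `1/k²`: `ρ/ρ_s(τ)` non-increasing (zero slack — the bet of the line).
[Ginibre, Comm. Math. Phys. 16 (1970) 310 (the kind of inequality); arXiv:1211.2778; Pitaevskii–Stringari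
1991; Gavoret–Nozières 1964; evidence ED j006865, j005099, j011503] -/
def SourceRaisesInteraction : Prop :=
  ∀ M : ℝ, 0 < M → ∀ R₀ : ℝ, ∃ ρ₀ : ℝ, 0 < ρ₀ ∧
    ∀ w : ℝ → ℝ≥0∞, Measurable w → (∀ r, R₀ < r → w r = 0) → (∃ B : ℝ, ∀ r, w r ≤ ENNReal.ofReal B) →
      ∀ m : ℕ, ∀ L : ℝ, 0 < L → ((m + 1 : ℕ) : ℝ) ≤ ρ₀ * L ^ 3 →
        ∀ n : Fin 3 → ℤ, n ≠ 0 → InWindow M m L n → SourceRaisesInteractionAt w m L n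

/-- **Stub C `stub_chordTransport`** (the engine; a theorem of real analysis).  For a bounded admissible `w`
and fixed `(m, L > 0, n ≠ 0)`: if the source raises the interaction at every point `τ • w`, `τ ∈ (0, 1]`, of
the ray, then every chord constant valid for the free gas at `(m, L, n)` is valid for `w`.  Mechanism:
`e(τ,s) = inf_Φ F_{τ•w,s}(Φ)` is finite (the free chord bounds `F` below) and concave in `τ ∈ [0, ∞)`,
continuous at `0⁺` (`W(Φ) < ∞`), with right Dini slopes squeezed by `τ⁻¹ · groundInteraction (τ•w) s`
(variational Hellmann–Feynman: test a `δ`-near-minimiser at `τ + h` with `δ = h²`; conversely every state is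
`δ`-near-minimal or pays `δ`); a continuous function with non-negative lower right Dini derivative on
`[ε, 1)` is non-decreasing (`image_le_of_liminf_slope_right_le_deriv_boundary` with a constant bound), so
`[e(·,s) − e(·,0)](1) ≥ [e(·,s) − e(·,0)](0⁺)`. [W. Thirring, Quantum Mathematical Physics §3.5; folklore] -/
def ChordTransport : Prop :=
  ∀ w : ℝ → ℝ≥0∞, IsRepulsiveFiniteRange w → (∃ B : ℝ, ∀ r, w r ≤ ENNReal.ofReal B) →
    ∀ m : ℕ, ∀ L : ℝ, 0 < L → ∀ n : Fin 3 → ℤ, n ≠ 0 →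
      (∀ τ : ℝ, 0 < τ → τ ≤ 1 → SourceRaisesInteractionAt (scalePot τ w) m L n) →
      ∀ C : ℝ, 0 < C → GDChordBody 0 C m L n → GDChordBody w C m L n

/-- **Stub D2 `stub_truncatedEnergyLSC`** — lower semicontinuity of the periodic ground-state energy under
truncation at fixed `(N, L)`: `E₀(v) ≤ ⨆_{h>0} E₀(min(v, h))` (the non-trivial half of
`E₀(min(v,h)) ↑ E₀(v)`; monotone convergence of closed forms + Rellich on the torus — proved in tree as
`…StaticResponseBoundTruncationCompactness.exists_limitProfile` — plus the statement that the Bose-symmetric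
periodic `C¹` class realises the infimum of the maximal hard-core form, `MaxFormBound`, the one missing fact
of `truncationLimit_of_maxFormBound` there). [B. Simon, J. Funct. Anal. 28 (1978) 377, Thms 3.1, 4.1;
LSSY2005 App. A] -/
def TruncatedEnergyLSC : Prop :=
  ∀ v : ℝ → ℝ≥0∞, IsRepulsiveFiniteRange v → ∀ m : ℕ, ∀ L : ℝ, 0 < L →
    periodicGroundStateEnergy v (m + 1) L ≤
      ⨆ (h : ℝ) (_ : 0 < h), periodicGroundStateEnergy (trunc v h) (m + 1) L

/-- **TruncationLimit** (hard cores, at fixed `(N, L)`): chord bodies of all truncations `min(v, h)`, `h > 0`,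
with the SAME constant give the chord body of `v`.  Reduced to `TruncatedEnergyLSC` by
`truncationLimit_of_lsc`. -/
def TruncationLimit : Prop :=
  ∀ v : ℝ → ℝ≥0∞, IsRepulsiveFiniteRange v → ∀ m : ℕ, ∀ L : ℝ, 0 < L → ∀ n : Fin 3 → ℤ, n ≠ 0 →
    ∀ C : ℝ, 0 < C → (∀ h : ℝ, 0 < h → GDChordBody (trunc v h) C m L n) → GDChordBody v C m L n

/-! ## §3 Audit names of the stub statements

`Goal.stub_x` abbreviates the statement of the registered stub `stub_x`, so that the skeleton audit
(`#h21_check_skeleton`, by-name policy on hypothesis heads) reads the hypotheses of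
`GaussianDominationCan_of` as exactly the declared stubs. -/

namespace Goal

/-- Statement of stub A1 `stub_modeBessel`. -/
abbrev stub_modeBessel : Prop := ModeBessel
/-- Statement of stub A2 `stub_thetaNorm`. -/
abbrev stub_thetaNorm : Prop := ThetaNorm
/-- Statement of stub A3 `stub_freeAnchorOf`. -/
abbrev stub_freeAnchorOf : Prop := FreeAnchorOf
/-- Statement of stub B `stub_sourceRaisesInteraction`. -/
abbrev stub_sourceRaisesInteraction : Prop := SourceRaisesInteraction
/-- Statement of stub C `stub_chordTransport`. -/
abbrev stub_chordTransport : Prop := ChordTransport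
/-- Statement of stub D2 `stub_truncatedEnergyLSC`. -/
abbrev stub_truncatedEnergyLSC : Prop := TruncatedEnergyLSC
/-- Statement of the bookkeeping stub `stub_compose`: the six stub statements imply the crux
`GaussianDominationCan` BY NAME (proved below; registered so that this shared vocabulary file lands as a
`--supports` file, precedent `BECThomsonPrincipleDefs.stub_compose`). -/
abbrev stub_compose : Prop :=
  stub_modeBessel → stub_thetaNorm → stub_freeAnchorOf → stub_sourceRaisesInteraction →
    stub_chordTransport → stub_truncatedEnergyLSC → BECThomsonPrinciple.GaussianDominationCan

end Goal

/-! ## §4 Glue (proved) and the composition -/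

/-- Truncations are bounded by the truncation height. [folklore] -/
theorem trunc_le (v : ℝ → ℝ≥0∞) (h : ℝ) (r : ℝ) : trunc v h r ≤ ENNReal.ofReal h :=
  min_le_right _ _

/-- Truncations lie below the potential. [folklore] -/
theorem trunc_le_self (v : ℝ → ℝ≥0∞) (h : ℝ) (r : ℝ) : trunc v h r ≤ v r :=
  min_le_left _ _

/-- Ray points of a bounded potential are bounded. [folklore] -/
theorem scalePot_le {w : ℝ → ℝ≥0∞} {B τ : ℝ} (hτ : 0 ≤ τ) (hB : ∀ r, w r ≤ ENNReal.ofReal B) (r : ℝ) :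
    scalePot τ w r ≤ ENNReal.ofReal (τ * B) := by
  unfold scalePot
  rw [ENNReal.ofReal_mul hτ]
  exact mul_le_mul' le_rfl (hB r)

/-- `v ↦ v^per` is monotone. [folklore] -/
theorem periodizedPotential_mono {w₁ w₂ : ℝ → ℝ≥0∞} (hw : ∀ r, w₁ r ≤ w₂ r) (L : ℝ) (x : Space) :
    periodizedPotential w₁ L x ≤ periodizedPotential w₂ L x := by
  unfold periodizedPotential
  exact ENNReal.tsum_le_tsum fun _ => hw _

/-- `v ↦ ∑_{i<j} v^per(xᵢ − xⱼ)` is monotone. [folklore] -/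
theorem periodicInteraction_mono {N : ℕ} {w₁ w₂ : ℝ → ℝ≥0∞} (hw : ∀ r, w₁ r ≤ w₂ r) (L : ℝ)
    (X : Config N) : periodicInteraction w₁ L X ≤ periodicInteraction w₂ L X := by
  unfold periodicInteraction
  exact Finset.sum_le_sum fun i _ => Finset.sum_le_sum fun j _ => periodizedPotential_mono hw L _

/-- `v ↦ E_v(Ψ)` is monotone. [folklore] -/
theorem periodicEnergy_mono {N : ℕ} {L : ℝ} {w₁ w₂ : ℝ → ℝ≥0∞} (hw : ∀ r, w₁ r ≤ w₂ r)
    (Ψ : PeriodicTrialState N L) : periodicEnergy w₁ Ψ ≤ periodicEnergy w₂ Ψ := by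
  unfold periodicEnergy
  exact lintegral_mono fun X =>
    add_le_add le_rfl (mul_le_mul' (periodicInteraction_mono hw L X) le_rfl)

/-- **Truncation glue**: `TruncatedEnergyLSC → TruncationLimit` — a chord valid for every truncation with
`h`-independent data is a chord for `v`, by `E_{min(v,h)}(Φ) ≤ E_v(Φ)` and `E₀(v) ≤ ⨆_h E₀(min(v,h))`.
[folklore] -/
theorem truncationLimit_of_lsc (hD : TruncatedEnergyLSC) : TruncationLimit := by
  intro v hv m L hL n _ C _ hall s hs Φ
  have hconv := hD v hv m L hL
  unfold GDIneq
  calc periodicGroundStateEnergy v (m + 1) L +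
        ENNReal.ofReal (s * (2 * (m + 1) * ‖sourceIntegral m L n Φ.ψ‖))
      ≤ (⨆ (h : ℝ) (_ : 0 < h), periodicGroundStateEnergy (trunc v h) (m + 1) L) +
          ENNReal.ofReal (s * (2 * (m + 1) * ‖sourceIntegral m L n Φ.ψ‖)) :=
        add_le_add hconv le_rfl
    _ = ⨆ (h : ℝ) (_ : 0 < h), (periodicGroundStateEnergy (trunc v h) (m + 1) L +
          ENNReal.ofReal (s * (2 * (m + 1) * ‖sourceIntegral m L n Φ.ψ‖))) :=
        ENNReal.biSup_add' ⟨1, one_pos⟩ _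
    _ ≤ periodicEnergy v Φ + ENNReal.ofReal (C * s ^ 2 * L ^ 2 / ‖(fun j => (n j : ℝ))‖ ^ 2) := by
        refine iSup₂_le fun h hh => ?_
        have h1 := hall h hh s hs Φ
        unfold GDIneq at h1
        exact h1.trans (add_le_add (periodicEnergy_mono (trunc_le_self v h) Φ) le_rfl)

/-- **Composition with explicit hypotheses**: FreeAnchor, the sign B, the transport C and the truncation
limit give the crux in `GDCanWith` form with `ρ₀ := ρ₀_B(M, R₀(v))`, `C := 1/(4π²)`, `N₀ := 0`.  For each
truncation level `h`, B supplies the sign along the whole ray of `min(v, h)` (a bounded admissible potential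
of range `R₀`, as is each `τ • min(v,h)`), C transports the free anchor to `min(v, h)`, and the truncation
limit passes to `h → ∞`. [folklore] -/
theorem gaussianDominationCan_of_parts (hA : FreeAnchor) (hB : SourceRaisesInteraction)
    (hC : ChordTransport) (hD : TruncationLimit) :
    ∀ v : ℝ → ℝ≥0∞, IsRepulsiveFiniteRange v → ∀ M : ℝ, 0 < M →
      ∃ ρ₀ C : ℝ, 0 < ρ₀ ∧ 0 < C ∧ ∃ N₀ : ℕ, GDCanWith ρ₀ C N₀ v M := by
  intro v hv M hM
  obtain ⟨hmeas, R₀, hR₀⟩ := hv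
  obtain ⟨ρ₀, hρ₀, hSRI⟩ := hB M hM R₀
  refine ⟨ρ₀, 1 / (4 * Real.pi ^ 2), hρ₀, by positivity, 0, ?_⟩
  intro m _ L hL hdens n hn hwin
  change GDChordBody v (1 / (4 * Real.pi ^ 2)) m L n
  refine hD v ⟨hmeas, R₀, hR₀⟩ m L hL n hn _ (by positivity) fun h _ => ?_
  have hmeas' : Measurable (trunc v h) := hmeas.min measurable_const
  have hrange : ∀ r, R₀ < r → trunc v h r = 0 := fun r hr => by
    show min (v r) (ENNReal.ofReal h) = 0
    rw [hR₀ r hr]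
    simp
  refine hC (trunc v h) ⟨hmeas', R₀, hrange⟩ ⟨h, trunc_le v h⟩ m L hL n hn ?_ _ (by positivity)
    (hA m L hL n hn)
  intro τ hτ _
  have hmeasτ : Measurable (scalePot τ (trunc v h)) := by
    unfold scalePot
    exact hmeas'.const_mul _
  have hrangeτ : ∀ r, R₀ < r → scalePot τ (trunc v h) r = 0 := fun r hr => by
    show ENNReal.ofReal τ * trunc v h r = 0
    rw [hrange r hr, mul_zero]
  exact hSRI (scalePot τ (trunc v h)) hmeasτ hrangeτ ⟨τ * h, scalePot_le hτ.le (trunc_le v h)⟩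
    m L hL hdens n hn hwin

/-- The composition behind the bookkeeping stub `stub_compose` (kernel-checked here; the registered stub
itself is discharged VERBATIM by this term in `Theorems/BECThomsonPrincipleGaussianDominationCanDefs.lean`,
precedent `BECThomsonPrincipleDefs.stub_compose`). [folklore] -/
theorem stub_compose_proof : Goal.stub_compose :=
  fun a1 a2 a3 b c d =>
    gaussianDominationCan_iff.mpr
      (gaussianDominationCan_of_parts (a3 a1 a2) b c (truncationLimit_of_lsc d))


/-! ## §5 Registered stubs (sorries only here; signatures EXPLICIT in landed vocabulary so that the
stub files `Theorems/BECThomsonPrincipleGaussianDominationCan<Stub>.lean` can state them verbatim before the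
Defs file lands; each is definitionally the named statement of §2) -/

/-- **Stub 0 `stub_compose`** (bookkeeping; proved as `stub_compose_proof` above and landed in the route's
`Defs` file): the six stub statements imply the crux BY NAME. [folklore] -/
theorem stub_compose : Goal.stub_compose := by
  sorry

/-- Stub A1 (M, provable now): one-mode gradient Bessel + Bose symmetry — `ModeBessel` verbatim. -/
theorem stub_modeBessel :
    ∀ m : ℕ, ∀ L : ℝ, 0 < L → ∀ n : Fin 3 → ℤ, ∀ Φ : PeriodicTrialState (m + 1) L,
      ENNReal.ofReal ((m + 1 : ℝ) * (4 * Real.pi ^ 2 * nsq n / L ^ 2)) *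
          ∫⁻ X in cellN (m + 1) L,
            (‖cellAvg (m + 1) L 0 (fun Y => (starRingEnd ℂ) (phase m L n Y) * Φ.ψ Y) X‖₊ : ℝ≥0∞) ^ 2 ≤
        ∫⁻ X in cellN (m + 1) L, kineticDensity Φ.ψ X := by
  sorry

/-- Stub A2 (M–L, provable now): Bose counting `N‖Θ‖² ≤ 1` — `ThetaNorm` verbatim. -/
theorem stub_thetaNorm :
    ∀ m : ℕ, ∀ L : ℝ, 0 < L → ∀ Φ : PeriodicTrialState (m + 1) L,
      ((m + 1 : ℕ) : ℝ≥0∞) * ∫⁻ X in cellN (m + 1) L, (‖theta m L Φ.ψ X‖₊ : ℝ≥0∞) ^ 2 ≤ 1 := by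
  sorry

/-- Stub A3 (M, provable now): the free anchor from A1 and A2 — `FreeAnchorOf` unfolded. -/
theorem stub_freeAnchorOf :
    (∀ m : ℕ, ∀ L : ℝ, 0 < L → ∀ n : Fin 3 → ℤ, ∀ Φ : PeriodicTrialState (m + 1) L,
      ENNReal.ofReal ((m + 1 : ℝ) * (4 * Real.pi ^ 2 * nsq n / L ^ 2)) *
          ∫⁻ X in cellN (m + 1) L,
            (‖cellAvg (m + 1) L 0 (fun Y => (starRingEnd ℂ) (phase m L n Y) * Φ.ψ Y) X‖₊ : ℝ≥0∞) ^ 2 ≤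
        ∫⁻ X in cellN (m + 1) L, kineticDensity Φ.ψ X) →
    (∀ m : ℕ, ∀ L : ℝ, 0 < L → ∀ Φ : PeriodicTrialState (m + 1) L,
      ((m + 1 : ℕ) : ℝ≥0∞) * ∫⁻ X in cellN (m + 1) L, (‖theta m L Φ.ψ X‖₊ : ℝ≥0∞) ^ 2 ≤ 1) →
    ∀ m : ℕ, ∀ L : ℝ, 0 < L → ∀ n : Fin 3 → ℤ, n ≠ 0 → ∀ s : ℝ, 0 ≤ s →
      ∀ Φ : PeriodicTrialState (m + 1) L, GDIneq 0 m L n (1 / (4 * Real.pi ^ 2)) s Φ := by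
  sorry

/-- Stub B (hardest; open): the source never lowers the ground-state interaction energy, dilute window. -/
theorem stub_sourceRaisesInteraction : SourceRaisesInteraction := by
  sorry

/-- Stub C (L, theorem): variational Hellmann–Feynman ⇒ chord transport along the coupling ray. -/
theorem stub_chordTransport : ChordTransport := by
  sorry

/-- Stub D2 (L–XL, theorem modulo `MaxFormBound`): `E₀(v) ≤ ⨆_h E₀(min(v,h))` at fixed `(N, L)` —
`TruncatedEnergyLSC` verbatim with `trunc` unfolded. -/
theorem stub_truncatedEnergyLSC :
    ∀ v : ℝ → ℝ≥0∞, IsRepulsiveFiniteRange v → ∀ m : ℕ, ∀ L : ℝ, 0 < L →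
      periodicGroundStateEnergy v (m + 1) L ≤
        ⨆ (h : ℝ) (_ : 0 < h),
          periodicGroundStateEnergy (fun r => min (v r) (ENNReal.ofReal h)) (m + 1) L := by
  sorry

/-! ## §6 The kernel-checked composition -/

/-- **The composition**: the registered stubs imply the crux BY NAME through the bookkeeping stub
`stub_compose` (whose proof is `stub_compose_proof`). -/
theorem GaussianDominationCan_of (c : Goal.stub_compose) (a1 : Goal.stub_modeBessel) (a2 : Goal.stub_thetaNorm)
    (a3 : Goal.stub_freeAnchorOf) (b : Goal.stub_sourceRaisesInteraction) (t : Goal.stub_chordTransport)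
    (d : Goal.stub_truncatedEnergyLSC) :
    _root_.Summit.AtomisticToContinuum.BoseEinsteinCondensation.Theses.BECThomsonPrinciple.GaussianDominationCan :=
  c a1 a2 a3 b t d

/-- The skeleton as a (sorried-through-the-stubs) proof of the crux: `_of` applied to the registered stubs. -/
theorem GaussianDominationCan_proof :
    _root_.Summit.AtomisticToContinuum.BoseEinsteinCondensation.Theses.BECThomsonPrinciple.GaussianDominationCan :=
  GaussianDominationCan_of stub_compose stub_modeBessel stub_thetaNorm stub_freeAnchorOf
    stub_sourceRaisesInteraction stub_chordTransport stub_truncatedEnergyLSC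

/-- The same with the bookkeeping stub discharged in-file (everything but the six real stubs is proved). -/
example : _root_.Summit.AtomisticToContinuum.BoseEinsteinCondensation.Theses.BECThomsonPrinciple.GaussianDominationCan :=
  GaussianDominationCan_of stub_compose_proof stub_modeBessel stub_thetaNorm stub_freeAnchorOf
    stub_sourceRaisesInteraction stub_chordTransport stub_truncatedEnergyLSC

/-! ## §7 Sanity checks against the landed Negative lemmas -/

/-- The anchor's constant is the least admissible one (`Negative.free_const_ge`): stub A is TIGHT. -/
example {ρ₀ M C : ℝ} {N₀ : ℕ} (hρ : 0 < ρ₀) (hM : 0 < M) (h : GDCanWith ρ₀ C N₀ 0 M) :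
    1 / (4 * Real.pi ^ 2) ≤ C :=
  Summit.AtomisticToContinuum.BoseEinsteinCondensation.Theorems.GaussianDominationCan.Negative.free_const_ge hρ hM h

/-- Stubs A1–A3 alone settle the crux instance `v = 0`: `GDCanWith ρ₀ (1/(4π²)) 0 0 M` for every `ρ₀, M`. -/
example (h1 : ModeBessel) (h2 : ThetaNorm) (h3 : FreeAnchorOf) (ρ₀ M : ℝ) :
    GDCanWith ρ₀ (1 / (4 * Real.pi ^ 2)) 0 0 M :=
  fun m _ L hL _ n hn _ => h3 h1 h2 m L hL n hn

end Summit.AtomisticToContinuum.BoseEinsteinCondensation.Cruxes.GaussianDominationCan.CouplingMonotoneChord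

end
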